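import Literature.Topology.Algebra.IdempotentUnitsSplitting
import HarnessLib

/-!
# Units supported off a central idempotent are the units of the quotient: `U_{1-e} ≅ (A / eA)ˣ`

Topic `Topology/Algebra`; small definitions with bodies (`liftUnitOfSection`,
`cornerUnitsEquivOfSection`, `cornerUnitsContinuousEquivOfSection`) and theorems; no named fact, no
instance. Continuation of `IdempotentUnitsSplitting` (`cornerUnits e = {u ∈ Aˣ : (1 - e) u = 1 - e}`,
`Aˣ ≅ U_e × U_{1-e}`).

Let `A` be a ring, `e ∈ A` a central idempotent, and `q : A →+* B` a ring homomorphism which is "the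
quotient by `eA`" in the following concrete sense: there is a map `σ : B → A` (not assumed additive or
multiplicative) with `q ∘ σ = id` and `σ ∘ q = (x ↦ (1 - e) x)` — as for the Peirce decomposition
`A = eA × (1 - e)A`, `B = (1 - e)A ≅ A / eA`, `q` the projection and `σ` the inclusion of the corner.
Then `q e = 0`, `q` identifies `x, y` iff `(1 - e) x = (1 - e) y`, and **`Units.map q` restricts to an
isomorphism of the group `U_{1-e} = cornerUnits (1 - e) = {u : e u = e}` of units supported off `e`
onto `Bˣ`** (`cornerUnitsEquivOfSection`), with inverse `u ↦ e + (1 - e) σ(u)` (`liftUnitOfSection`);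
for topological rings and continuous `q`, `σ` it is an isomorphism of topological groups
(`cornerUnitsContinuousEquivOfSection`, units topologies).

Use (in `Literature/NumberTheory/Automorphic`): with `e = e_S` the idempotent of a finite set `S` of
finite places of a number field `K`, `A = M_n(𝔸_K)` or `A = 𝔸_K ⊗_K D`, and `B` the same algebra over
the adeles away from `S`, `𝔸_K^S = 𝔸_K / e_S 𝔸_K`: the groups `G^S = {g : g_v = 1, v ∈ S}` of the
comparison of trace formulas (Gelbart (1975), §10, p. 153, "`G_𝔸 = G_S × G^S`", "`G_S = G'_S`") are
`GL_n(𝔸_K^S)` and `(𝔸_K^S ⊗_K D)ˣ`. Part of the inline (D-0026) decomposition of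
`Literature.NumberTheory.Automorphic.strong_multiplicity_one_quaternionUnits`.

## References

* T. Y. Lam, *A first course in noncommutative rings*, 2nd ed., GTM 131 (2001), §21 (Peirce
  decompositions) — folklore.
* S. Gelbart, *Automorphic forms on adele groups* (1975), §10, p. 153 [Gelbart1975].
-/

namespace Literature.Topology.Algebra

section Ring

variable {A B : Type*} [Ring A] [Ring B] {e : A}
  (he : IsIdempotentElem e) (hc : e ∈ Subring.center A) (q : A →+* B) (σ : B → A)
  (hqσ : ∀ y, q (σ y) = y) (hσq : ∀ x, σ (q x) = (1 - e) * x)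

include hσq in
/-- `σ 1 = 1 - e`. [folklore] -/
theorem section_one : σ 1 = 1 - e := by
  rw [← map_one q, hσq, mul_one]

include hqσ hσq in
/-- `q (1 - e) = 1`. [folklore] -/
theorem map_one_sub_idem : q (1 - e) = 1 := by
  rw [← section_one q σ hσq, hqσ]

include hqσ hσq in
/-- **`q e = 0`**: the idempotent dies in the quotient. [folklore] -/
theorem map_idem : q e = 0 := by
  have h := map_one_sub_idem q σ hqσ hσq
  rw [map_sub, map_one, sub_eq_self] at h
  exact h

include hqσ hσq in
/-- **`q x = q y` iff `(1 - e) x = (1 - e) y`** (the kernel of `q` is `eA`). [folklore] -/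
theorem map_eq_map_iff (x y : A) : q x = q y ↔ (1 - e) * x = (1 - e) * y := by
  constructor
  · intro h
    rw [← hσq, ← hσq, h]
  · intro h
    have h' := congrArg q h
    rwa [map_mul, map_mul, map_one_sub_idem q σ hqσ hσq, one_mul, one_mul] at h'

include hqσ hσq in
/-- `(1 - e) σ(y) σ(y') = (1 - e) σ(y y')` (`σ` is multiplicative up to the corner). [folklore] -/
theorem one_sub_mul_section_mul (y y' : B) : (1 - e) * (σ y * σ y') = (1 - e) * σ (y * y') := by
  rw [← map_eq_map_iff q σ hqσ hσq, map_mul, hqσ, hqσ, hqσ]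

include hqσ hσq in
/-- `(1 - e) σ(y) = σ(y)`: `σ` takes values in the corner `(1 - e)A`. [folklore] -/
theorem one_sub_mul_section (y : B) : (1 - e) * σ y = σ y := by
  have h := hσq (σ y)
  rw [hqσ] at h
  exact h.symm

include he hc hqσ hσq in
/-- The product formula behind the lift: `(e + (1 - e) σ u)(e + (1 - e) σ u') = e + (1 - e) σ(u u')`.
[folklore] -/
theorem idem_add_mul_section_mul (u u' : B) :
    (e + (1 - e) * σ u) * (e + (1 - e) * σ u') = e + (1 - e) * σ (u * u') := by
  have hce : ∀ x : A, x * e = e * x := fun x => Subring.mem_center_iff.1 hc x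
  have h1 : (e + (1 - e) * σ u) * (e + (1 - e) * σ u') =
      e * e + e * ((1 - e) * σ u') + (1 - e) * σ u * e + (1 - e) * σ u * ((1 - e) * σ u') := by
    noncomm_ring
  rw [h1, he.eq, ← mul_assoc e (1 - e), mul_one_sub_eq_zero he, zero_mul, add_zero, mul_assoc (1 - e) (σ u) e,
    hce, ← mul_assoc (1 - e) e, one_sub_mul_eq_zero he, zero_mul, add_zero, mul_assoc (1 - e) (σ u),
    ← mul_assoc (σ u) (1 - e), Subring.mem_center_iff.1 (one_sub_mem_center hc) (σ u), mul_assoc (1 - e) (σ u),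
    ← mul_assoc (1 - e) (1 - e), he.one_sub.eq, one_sub_mul_section_mul q σ hqσ hσq]

/-- **The lift of a unit of `B` to a unit of `A` supported off `e`**: `u ↦ e + (1 - e) σ(u)` with
inverse `e + (1 - e) σ(u⁻¹)`. [folklore] -/
def liftUnitOfSection (u : Bˣ) : Aˣ where
  val := e + (1 - e) * σ u
  inv := e + (1 - e) * σ (u⁻¹ : Bˣ)
  val_inv := by
    rw [idem_add_mul_section_mul he hc q σ hqσ hσq, Units.mul_inv, section_one q σ hσq, he.one_sub.eq,
      add_sub_cancel]
  inv_val := by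
    rw [idem_add_mul_section_mul he hc q σ hqσ hσq, Units.inv_mul, section_one q σ hσq, he.one_sub.eq,
      add_sub_cancel]

/-- `liftUnitOfSection u = e + (1 - e) σ u` in `A` (definitional). [folklore] -/
@[simp]
theorem coe_liftUnitOfSection (u : Bˣ) :
    ((liftUnitOfSection he hc q σ hqσ hσq u : Aˣ) : A) = e + (1 - e) * σ u := rfl

/-- `(liftUnitOfSection u)⁻¹ = e + (1 - e) σ u⁻¹` in `A` (definitional). [folklore] -/
@[simp]
theorem coe_inv_liftUnitOfSection (u : Bˣ) :
    (((liftUnitOfSection he hc q σ hqσ hσq u)⁻¹ : Aˣ) : A) = e + (1 - e) * σ (u⁻¹ : Bˣ) := rfl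

/-- The lift is supported off `e`: `liftUnitOfSection u ∈ U_{1-e}`. [folklore] -/
theorem liftUnitOfSection_mem (u : Bˣ) : liftUnitOfSection he hc q σ hqσ hσq u ∈ cornerUnits (1 - e) := by
  rw [mem_cornerUnits_iff, sub_sub_cancel, coe_liftUnitOfSection, mul_add, he.eq, ← mul_assoc,
    mul_one_sub_eq_zero he, zero_mul, add_zero]

/-- `q` of the lift is the unit we started with. [folklore] -/
theorem map_liftUnitOfSection (u : Bˣ) : Units.map (q : A →* B) (liftUnitOfSection he hc q σ hqσ hσq u) = u :=
  Units.ext (by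
    rw [Units.coe_map, MonoidHom.coe_coe, coe_liftUnitOfSection, map_add, map_mul, map_idem q σ hqσ hσq,
      map_one_sub_idem q σ hqσ hσq, hqσ, zero_add, one_mul])

/-- The lift of `q U` is `U` for `U` supported off `e`. [folklore] -/
theorem liftUnitOfSection_map {U : Aˣ} (hU : U ∈ cornerUnits (1 - e)) :
    liftUnitOfSection he hc q σ hqσ hσq (Units.map (q : A →* B) U) = U := by
  refine Units.ext ?_
  rw [mem_cornerUnits_iff, sub_sub_cancel] at hU
  rw [coe_liftUnitOfSection, Units.coe_map, MonoidHom.coe_coe, hσq, ← mul_assoc, he.one_sub.eq]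
  calc e + (1 - e) * (U : A) = e * U + (1 - e) * U := by rw [hU]
    _ = U := by rw [← add_mul, add_sub_cancel, one_mul]

/-- **`U_{1-e} ≅ Bˣ`**: `Units.map q` restricted to the units supported off `e` is a group
isomorphism onto the units of the quotient, with inverse the lift `u ↦ e + (1 - e) σ(u)`
(for `A = eA × B`: `(eA × B)ˣ ∩ ({1} × B) ≅ Bˣ`). [folklore] -/
def cornerUnitsEquivOfSection : cornerUnits (1 - e) ≃* Bˣ where
  toFun U := Units.map (q : A →* B) (U : Aˣ)
  invFun u := ⟨liftUnitOfSection he hc q σ hqσ hσq u, liftUnitOfSection_mem he hc q σ hqσ hσq u⟩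
  left_inv U := Subtype.ext (liftUnitOfSection_map he hc q σ hqσ hσq U.2)
  right_inv u := map_liftUnitOfSection he hc q σ hqσ hσq u
  map_mul' U V := by rw [Subgroup.coe_mul, map_mul]

/-- `cornerUnitsEquivOfSection U = Units.map q U` (definitional). [folklore] -/
@[simp]
theorem cornerUnitsEquivOfSection_apply (U : cornerUnits (1 - e)) :
    cornerUnitsEquivOfSection he hc q σ hqσ hσq U = Units.map (q : A →* B) (U : Aˣ) := rfl

/-- The inverse is the lift (definitional). [folklore] -/
@[simp]
theorem cornerUnitsEquivOfSection_symm_apply (u : Bˣ) :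
    (((cornerUnitsEquivOfSection he hc q σ hqσ hσq).symm u : cornerUnits (1 - e)) : Aˣ) =
      liftUnitOfSection he hc q σ hqσ hσq u := rfl

include he hc hqσ hσq in
/-- **`Units.map q` is onto**: every unit of the quotient lifts to a unit of `A` supported off `e`.
[folklore] -/
theorem units_map_surjective : Function.Surjective (Units.map (q : A →* B)) := fun u =>
  ⟨liftUnitOfSection he hc q σ hqσ hσq u, map_liftUnitOfSection he hc q σ hqσ hσq u⟩

include hqσ hσq in
/-- `Units.map q U = 1` iff `U ∈ U_e` (i.e. `(1 - e) U = 1 - e`). [folklore] -/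
theorem units_map_eq_one_iff (U : Aˣ) : Units.map (q : A →* B) U = 1 ↔ U ∈ cornerUnits e := by
  rw [mem_cornerUnits_iff, Units.ext_iff, Units.coe_map, MonoidHom.coe_coe, Units.val_one, ← map_one q,
    map_eq_map_iff q σ hqσ hσq, mul_one]

end Ring

/-! ### Topology -/

section Topology

variable {A B : Type*} [Ring A] [Ring B] [TopologicalSpace A] [IsTopologicalRing A]
  [TopologicalSpace B] {e : A}
  (he : IsIdempotentElem e) (hc : e ∈ Subring.center A) (q : A →+* B) (σ : B → A)
  (hqσ : ∀ y, q (σ y) = y) (hσq : ∀ x, σ (q x) = (1 - e) * x)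

/-- The lift `Bˣ → Aˣ` is continuous for continuous `σ` (units topologies). [folklore] -/
theorem continuous_liftUnitOfSection (hσc : Continuous σ) :
    Continuous (liftUnitOfSection he hc q σ hqσ hσq) := by
  refine Units.continuous_iff.2 ⟨?_, ?_⟩
  · change Continuous fun u : Bˣ => e + (1 - e) * σ (u : B)
    exact continuous_const.add (continuous_const.mul (hσc.comp Units.continuous_val))
  · change Continuous fun u : Bˣ => e + (1 - e) * σ ((u⁻¹ : Bˣ) : B)
    exact continuous_const.add (continuous_const.mul (hσc.comp Units.continuous_coe_inv))

/-- **`U_{1-e} ≃ₜ* Bˣ` as topological groups** for continuous `q` and `σ` (units topologies; `U_{1-e}`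
with the subspace topology of `Aˣ`). [folklore] -/
def cornerUnitsContinuousEquivOfSection (hqc : Continuous q) (hσc : Continuous σ) :
    cornerUnits (1 - e) ≃ₜ* Bˣ :=
  { cornerUnitsEquivOfSection he hc q σ hqσ hσq with
    continuous_toFun := by
      change Continuous fun U : cornerUnits (1 - e) => Units.map (q : A →* B) (U : Aˣ)
      exact (Continuous.units_map _ hqc).comp continuous_subtype_val
    continuous_invFun := by
      change Continuous fun u : Bˣ =>
        (⟨liftUnitOfSection he hc q σ hqσ hσq u, liftUnitOfSection_mem he hc q σ hqσ hσq u⟩ : cornerUnits (1 - e))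
      exact (continuous_liftUnitOfSection he hc q σ hqσ hσq hσc).subtype_mk _ }

/-- The topological isomorphism is `Units.map q` (definitional). [folklore] -/
@[simp]
theorem cornerUnitsContinuousEquivOfSection_apply (hqc : Continuous q) (hσc : Continuous σ)
    (U : cornerUnits (1 - e)) :
    cornerUnitsContinuousEquivOfSection he hc q σ hqσ hσq hqc hσc U = Units.map (q : A →* B) (U : Aˣ) := rfl

/-- Its inverse is the lift (definitional). [folklore] -/
@[simp]
theorem cornerUnitsContinuousEquivOfSection_symm_apply (hqc : Continuous q) (hσc : Continuous σ) (u : Bˣ) :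
    (((cornerUnitsContinuousEquivOfSection he hc q σ hqσ hσq hqc hσc).symm u : cornerUnits (1 - e)) : Aˣ) =
      liftUnitOfSection he hc q σ hqσ hσq u := rfl

end Topology

end Literature.Topology.Algebra
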